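import Mathlib
import HarnessLib
import Summits.HubbardSuperconductivity.HubbardSuperconductivity.Theorems.KLProgrammeKLRegimeEngineTowerLevNumericsPackageZN
import Summits.HubbardSuperconductivity.HubbardSuperconductivity.Theorems.KLProgrammeKLRegimeEngineTowerWtNumericsPins

/-!
# Route `KLProgramme` — crux K3 ENGINE (stmt-HubbardSuperconductivity-20437 `KLRegimeEngineV17F2`), stub (b) v2, THE WEIGHTED HALF «(b)-WT4», numerics side
# «part 4» (e) (cell gate-hubbard-kl, seat p4 g22): THE WEIGHTED BLOCK-0 NUMERICS PACKAGE WITH THE TWO-LEG SLOT AS A PRODUCT BOUND — the twin of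
# `levNumerics_packageZN` (…TowerLevNumericsPackageZN) in the WEIGHTED pin system of W14/W14♯ (`kernelNormsWt4_all_klEng_final[_sharp]`, k3c3-p2 g17)

W14's block-`0` groups (the BASE group at the read-out rates and the LEVELS group `1 ≤ j < d`) are keyed on the level-`0` weighted datum `(A₁, P₁, T₁)`: names
`Ab₀ = A₁ε_x/Klam²/B²`, `Qb₀ = P₁/ε_x²`, weighted pins `αb₀ = Cα·(M/β)`, `κb₀ = √(2Cκ₀e₀)`, `crb₀ ccb₀`, `W₀ = 32crb₀/ccb₀`, `Z₀ = ε_x²ccb₀²/8`, `σ₀ τ₀ ψ₀ Φ₀`,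
dominations `W₀Ab₀ ≤ A′₀`, `Z₀Qb₀ ≤ Q′₀`, `W₀Z₀³Ab₀Qb₀³ ≤ ι₃₀`, the two-leg row `W₀Z₀·T₁(|U| + c)/ε_x ≤ ι₁₀·λ` (which is `O(|U| + c)`, not `O(λ)` — located
«(b)-WT4-BLOCK0-RATE»: the slot must be read per rate), the four-leg row `W₀Z₀²·A₁P₁²|U|/ε_x³ ≤ ι₂₀·λ`, five smallness rows, a kit guard on a majorant array, and the
read-out names with a domination / a CE row.  This package = `levNumerics_packageZW` with `levNumerics_packageZN`'s product-bound two-leg slot: pins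
`A′₀ := W₀·Ab₀`, `Q′₀ := Z₀Qb₀ + 1`, `ι₃₀ := A′₀Q′₀³`; data shapes `Ab₀ = ab₀·(β/M)/Bf²`, `Qb₀ = qb₀·(M/β)²`, `0 ≤ ι₂₀ ≤ i₂₀·(M/β)³/Bf`; per coupling a free
`ι₁₀ ≥ 0` with `ι₁₀·λ ≤ (M/β)/Bf`; closed forms with the weighted `s₀₀ t₀₀ p₀₀ φ₀₀` (`φ₀₀ = e·Cα/(Cκ₀e₀)`), `W₀₀ = 16`, `aP₀ = W₀₀ab₀`, no `i₁₀`-door, `Θ₀` without the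
two-leg term, `Bf ≥ 4e·φ₀₀t₀₀(1 + ŝC₀)`.
**`levNumerics_packageZWN`**: `0 < uf₀ ∧ 0 < aT₁ ∧ 0 < qT₁ ∧ 0 ≤ CEf₀` and for all `0 < β ≤ M` and the shaped data/pins: (o) signs (incl. `Z₀Qb₀ ≤ Q′₀`,
`Z₀³Qb₀³ ≤ Q′₀³`); (i) the FIVE STRICT SMALLNESS ROWS for every `0 ≤ λ ≤ uf₀`, `ι₁₀ ≥ 0` with `ι₁₀λ ≤ (M/β)/Bf`; (ii) the CE row; (iii) the DOMINATION
`Atot(λ) ≤ aT₁·(β/M)/Bf²`, `Qtot ≤ qT₁·(M/β)²`; (iv) the kit GUARD for any array with the four-piece rows at `λ`.  Pure real arithmetic; nothing about the model is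
asserted; nothing asserts (b), WT4, (ℓ), any stub, K3 or superconductivity.
References: BGM 2006 §2.8 (2.83)–(2.84), (2.93)–(2.98), Lemma 2.5 (2.98) [cite: BenfattoGiulianiMastropietro2006].
-/

noncomputable section

namespace Summit.HubbardSuperconductivity.HubbardSuperconductivity.Theorems.EngineV8

set_option linter.dupNamespace false -- summit = problem name (single-conjunct summit), D-0017

open Real Literature.MathematicalPhysics.QuantumLattice
open Summit.HubbardSuperconductivity.HubbardSuperconductivity.Theorems.KLRegimeSplit


set_option maxHeartbeats 1600000 in -- one ~50-binder statement with ~20 closed forms and four long conclusions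
/-- **THE WEIGHTED BLOCK-0 NUMERICS PACKAGE, PRODUCT-BOUND TWO-LEG SLOT** (see the module docstring for the closed forms and the conclusions (o)–(iv)).
[cite: BenfattoGiulianiMastropietro2006, §2.8 (2.83)-(2.84), (2.93)-(2.98), Lemma 2.5 (2.98)] -/
theorem levNumerics_packageZWN
    {Cinc₀ Dinc₀ Cinc₁ Dinc₁ Cκ₀ Cα CJ₀ ab₀ qb₀ i₂₀ : ℝ}
    (hCinc₀ : 0 < Cinc₀) (hDinc₀ : 1 ≤ Dinc₀) (hCinc₁ : 1 ≤ Cinc₁) (hDinc₁ : 1 ≤ Dinc₁) (hCκ₀ : 0 < Cκ₀) (hCα : 0 < Cα) (hCJ₀ : 0 < CJ₀)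
    (hab₀ : 0 < ab₀) (hqb₀ : 0 < qb₀) (hi₂₀ : 0 ≤ i₂₀)
    -- the r-free closed forms (instantiate with `rfl`)
    {W₀₀ Z₀₀ s₀₀ t₀₀ p₀₀ φ₀₀ QL₀ QH₀ aP₀ sC₀ Θ₀ uf₀ aT₀ aT₁ qT₀ qT₁ CEf₀ : ℝ} {Bf : ℝ}
    (hW₀₀ : W₀₀ = 16) (hZ₀₀ : Z₀₀ = (81 * CJ₀) ^ 2 / 8)
    (hs₀₀ : s₀₀ = 2 * Cκ₀ * klE0 / (162 ^ 2 * CJ₀ ^ 2)) (ht₀₀ : t₀₀ = 4 * exp 4 * (2 * Cκ₀ * klE0) / (162 ^ 2 * CJ₀ ^ 2))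
    (hp₀₀ : p₀₀ = 162 ^ 2 * CJ₀ ^ 2 / (2 * Cκ₀ * klE0)) (hφ₀₀ : φ₀₀ = exp 1 * Cα / (Cκ₀ * klE0))
    (hQL₀ : QL₀ = Z₀₀ * qb₀) (hQH₀ : QH₀ = Z₀₀ * qb₀ + 1) (haP₀ : aP₀ = W₀₀ * ab₀)
    (hsC₀ : sC₀ = i₂₀ / (2 * QL₀) + aP₀ * QH₀ ^ 3 / (4 * QL₀ ^ 2) + aP₀ * QH₀ / 4)
    (hΘ₀ : Θ₀ = exp 1 ^ 2 * φ₀₀ * t₀₀ ^ 2 * i₂₀ + exp 1 ^ 3 * φ₀₀ * t₀₀ ^ 3 * (aP₀ * QH₀ ^ 3) + exp 1 ^ 3 * φ₀₀ * t₀₀ ^ 3 * aP₀ * QH₀ ^ 3)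
    (huf₀ : uf₀ = min 1 (min (1 / (8 * s₀₀ * QH₀ + 1)) (min (1 / (2 * exp 1 * t₀₀ * QH₀ + 1)) (1 / (4 * Θ₀ + 1)))))
    (haT₀ : aT₀ = Cinc₀ * (ab₀ + aP₀ + exp 1 * φ₀₀ * t₀₀ * (1 + sC₀) ^ 2 / QL₀))
    (haT₁ : aT₁ = Cinc₁ * (ab₀ + aP₀ + exp 1 * φ₀₀ * t₀₀ * (1 + sC₀) ^ 2 / QL₀))
    (hqT₀ : qT₀ = Dinc₀ * (1 + Dinc₀ * qb₀ + 4 * QH₀ + 2 * t₀₀ * p₀₀ * QH₀) / 4)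
    (hqT₁ : qT₁ = Dinc₁ * (1 + Dinc₁ * qb₀ + 4 * QH₀ + 2 * t₀₀ * p₀₀ * QH₀))
    (hCEf₀ : CEf₀ = qT₀ * Bf * max 1 (2 * aT₀))
    -- ANY `Bf` above block 0's threshold (it also absorbs the two-leg slot)
    (hBf1 : 1 ≤ Bf) (hBf₀ : 4 * exp 1 * φ₀₀ * t₀₀ * (1 + sC₀) ≤ Bf) :
    0 < uf₀ ∧ 0 < aT₁ ∧ 0 < qT₁ ∧ 0 ≤ CEf₀ ∧
    ∀ (β : ℝ) (M : ℕ) [NeZero M], 0 < β → β ≤ M →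
    -- the level-0 datum SHAPES and the four-leg slot ON ITS SHAPE (already carrying its `1/Bf`)
    ∀ (Ab₀ Qb₀ ι₂₀ : ℝ), Ab₀ = ab₀ * (β / M) / Bf ^ 2 → Qb₀ = qb₀ * ((M : ℝ) / β) ^ 2 → 0 ≤ ι₂₀ → ι₂₀ ≤ i₂₀ * ((M : ℝ) / β) ^ 3 / Bf →
    -- block 0's WEIGHTED pins and names (equational, W14's order)
    ∀ (αb₀ κb₀ crb₀ ccb₀ W₀ Z₀ σ₀ τ₀ ψ₀ Φ₀ : ℝ), αb₀ = Cα * ((M : ℝ) / β) → κb₀ = Real.sqrt (2 * Cκ₀ * klE0) → crb₀ = 81 * CJ₀ * M / β →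
      ccb₀ = 162 * CJ₀ * M / β → W₀ = 32 * crb₀ / ccb₀ → Z₀ = imagTimeWeight β M ^ 2 * ccb₀ ^ 2 / 8 → σ₀ = κb₀ ^ 2 / ccb₀ ^ 2 →
      τ₀ = 4 * exp 4 * κb₀ ^ 2 / ccb₀ ^ 2 → ψ₀ = ccb₀ ^ 2 / κb₀ ^ 2 → Φ₀ = exp 1 * αb₀ * ccb₀ / (κb₀ ^ 2 * crb₀) →
    -- the Chernoff profile PINNED on the datum (equational)
    ∀ (A'₀ Q'₀ ι₃₀ : ℝ), A'₀ = W₀ * Ab₀ → Q'₀ = Z₀ * Qb₀ + 1 → ι₃₀ = A'₀ * Q'₀ ^ 3 →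
    -- (o) signs
    (0 ≤ Ab₀ ∧ 0 ≤ Qb₀ ∧ 0 ≤ A'₀ ∧ 0 < Q'₀ ∧ Z₀ * Qb₀ ≤ Q'₀ ∧ 0 ≤ ι₃₀ ∧ Z₀ ^ 3 * Qb₀ ^ 3 ≤ Q'₀ ^ 3 ∧ 0 ≤ Φ₀ ∧ 0 ≤ τ₀ ∧ 0 < W₀ ∧ 0 < Z₀) ∧
    -- (i) the five STRICT smallness rows at every coupling below `uf₀`, for every two-leg slot within the product bound
    (∀ lam ι₁₀' : ℝ, 0 ≤ lam → lam ≤ uf₀ → 0 ≤ ι₁₀' → ι₁₀' * lam ≤ ((M : ℝ) / β) / Bf →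
      4 * σ₀ * lam * Q'₀ < 1 ∧ 2 * lam * τ₀ * Q'₀ ≤ 1 ∧ exp 1 * τ₀ * lam * Q'₀ < 1 ∧
      Φ₀ * (τ₀ * (ι₁₀' * lam + ι₂₀ / (2 * Q'₀) + ι₃₀ / (4 * Q'₀ ^ 2) + A'₀ * Q'₀ / 4)) < 1 ∧
      Φ₀ * (exp 1 * τ₀ * (ι₁₀' * lam) + (exp 1 * τ₀) ^ 2 * (ι₂₀ * lam) + (exp 1 * τ₀) ^ 3 * (ι₃₀ * lam ^ 2) +
        A'₀ * (exp 1 * τ₀ * Q'₀) * ((exp 1 * τ₀ * lam * Q'₀) ^ 3 / (1 - exp 1 * τ₀ * lam * Q'₀))) < 1) ∧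
    -- (ii) the CE row of the levels `1 ≤ j < d` (constants `Cinc₀ Dinc₀`)
    (∀ lam ι₁₀' : ℝ, 0 ≤ lam → lam ≤ uf₀ → 0 ≤ ι₁₀' → ι₁₀' * lam ≤ ((M : ℝ) / β) / Bf → ∀ (Aro Qro Qtot Atot : ℝ), Aro = Cinc₀ * Ab₀ → Qro = Dinc₀ * Qb₀ →
      Qtot = Dinc₀ * max 1 (max Qro (max (4 * Q'₀) (2 * τ₀ * ψ₀ * Q'₀))) →
      Atot = Aro + Cinc₀ * (A'₀ * (4 * σ₀ * lam * Q'₀ / (1 - 4 * σ₀ * lam * Q'₀)) +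
        exp 1 * (τ₀ * (ι₁₀' * lam + ι₂₀ / (2 * Q'₀) + ι₃₀ / (4 * Q'₀ ^ 2) + A'₀ * Q'₀ / 4)) *
          (Φ₀ * (τ₀ * (ι₁₀' * lam + ι₂₀ / (2 * Q'₀) + ι₃₀ / (4 * Q'₀ ^ 2) + A'₀ * Q'₀ / 4)) /
            (1 - Φ₀ * (τ₀ * (ι₁₀' * lam + ι₂₀ / (2 * Q'₀) + ι₃₀ / (4 * Q'₀ ^ 2) + A'₀ * Q'₀ / 4)))) / (2 * τ₀ * Q'₀)) →
      Qtot * imagTimeWeight β M ^ 2 * Bf * max 1 (Atot / imagTimeWeight β M) ≤ CEf₀) ∧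
    -- (iii) the DOMINATION of the base read-out constants (constants `Cinc₁ Dinc₁`) by the amplitudes-to-be `aT₁·(β/M)/Bf²`, `qT₁·(M/β)²`
    (∀ lam ι₁₀' : ℝ, 0 ≤ lam → lam ≤ uf₀ → 0 ≤ ι₁₀' → ι₁₀' * lam ≤ ((M : ℝ) / β) / Bf → ∀ (Aro Qro Qtot Atot : ℝ), Aro = Cinc₁ * Ab₀ → Qro = Dinc₁ * Qb₀ →
      Qtot = Dinc₁ * max 1 (max Qro (max (4 * Q'₀) (2 * τ₀ * ψ₀ * Q'₀))) →
      Atot = Aro + Cinc₁ * (A'₀ * (4 * σ₀ * lam * Q'₀ / (1 - 4 * σ₀ * lam * Q'₀)) +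
        exp 1 * (τ₀ * (ι₁₀' * lam + ι₂₀ / (2 * Q'₀) + ι₃₀ / (4 * Q'₀ ^ 2) + A'₀ * Q'₀ / 4)) *
          (Φ₀ * (τ₀ * (ι₁₀' * lam + ι₂₀ / (2 * Q'₀) + ι₃₀ / (4 * Q'₀ ^ 2) + A'₀ * Q'₀ / 4)) /
            (1 - Φ₀ * (τ₀ * (ι₁₀' * lam + ι₂₀ / (2 * Q'₀) + ι₃₀ / (4 * Q'₀ ^ 2) + A'₀ * Q'₀ / 4)))) / (2 * τ₀ * Q'₀)) →
      Atot ≤ aT₁ * (β / M) / Bf ^ 2 ∧ Qtot ≤ qT₁ * ((M : ℝ) / β) ^ 2) ∧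
    -- (iv) the kit GUARD for any array with the four-piece Chernoff rows at `λ`
    (∀ lam ι₁₀' : ℝ, 0 ≤ lam → lam ≤ uf₀ → 0 ≤ ι₁₀' → ι₁₀' * lam ≤ ((M : ℝ) / β) / Bf → ∀ (D : ℕ) (μ : ℕ → ℝ), (∀ m, 0 ≤ μ m) →
      μ 1 ≤ ι₁₀' * lam → μ 2 ≤ ι₂₀ * lam → μ 3 ≤ ι₃₀ * lam ^ 2 → (∀ m, 4 ≤ m → m ≤ D → μ m ≤ A'₀ * lam ^ (m - 1) * Q'₀ ^ m) → Φ₀ * towerV D τ₀ μ < 1) := by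
  -- §0 positivity of the r-free closed forms
  have he0 : (0 : ℝ) < klE0 := by norm_num [klE0]
  have hW₀₀0 : 0 < W₀₀ := by rw [hW₀₀]; positivity
  have hZ₀₀0 : 0 < Z₀₀ := by rw [hZ₀₀]; positivity
  have hs₀₀0 : 0 < s₀₀ := by rw [hs₀₀]; positivity
  have ht₀₀0 : 0 < t₀₀ := by rw [ht₀₀]; positivity
  have hp₀₀0 : 0 < p₀₀ := by rw [hp₀₀]; positivity
  have hφ₀₀0 : 0 < φ₀₀ := by rw [hφ₀₀]; positivity
  have hQL₀0 : 0 < QL₀ := by rw [hQL₀]; positivity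
  have hQH₀0 : 0 < QH₀ := by rw [hQH₀]; positivity
  have haP₀0 : 0 < aP₀ := by rw [haP₀]; positivity
  have hsC₀0 : 0 ≤ sC₀ := by rw [hsC₀]; positivity
  have hΘ₀0 : 0 ≤ Θ₀ := by rw [hΘ₀]; positivity
  have huf₀0 : 0 < uf₀ := by rw [huf₀]; positivity
  have hC₁0 : 0 < Cinc₁ := lt_of_lt_of_le one_pos hCinc₁
  have hD₀0 : 0 ≤ Dinc₀ := le_trans zero_le_one hDinc₀
  have hD₁0 : 0 < Dinc₁ := lt_of_lt_of_le one_pos hDinc₁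
  have haT₀0 : 0 ≤ aT₀ := by rw [haT₀]; positivity
  have haT₁0 : 0 < aT₁ := by rw [haT₁]; positivity
  have hqT₀0 : 0 ≤ qT₀ := by rw [hqT₀]; positivity
  have hqT₁0 : 0 < qT₁ := by rw [hqT₁]; positivity
  have hBf0 : 0 < Bf := lt_of_lt_of_le one_pos hBf1
  have hCEf₀0 : 0 ≤ CEf₀ := by rw [hCEf₀]; exact mul_nonneg (mul_nonneg hqT₀0 hBf0.le) (le_trans zero_le_one (le_max_left _ _))
  have he1 : (1 : ℝ) ≤ exp 1 := Real.one_le_exp (by norm_num)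
  -- the two-leg slot is absorbed by `Bf`: `4φ₀₀t₀₀(1 + ŝC₀) ≤ Bf` and `4e·φ₀₀t₀₀ ≤ Bf`
  have hBfs : 4 * φ₀₀ * t₀₀ * (1 + sC₀) ≤ Bf := by
    have h0 : 0 ≤ 4 * φ₀₀ * t₀₀ * (1 + sC₀) := by positivity
    calc 4 * φ₀₀ * t₀₀ * (1 + sC₀) = 4 * φ₀₀ * t₀₀ * (1 + sC₀) * 1 := (mul_one _).symm
      _ ≤ 4 * φ₀₀ * t₀₀ * (1 + sC₀) * exp 1 := mul_le_mul_of_nonneg_left he1 h0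
      _ = 4 * exp 1 * φ₀₀ * t₀₀ * (1 + sC₀) := by ring
      _ ≤ Bf := hBf₀
  have hBfe : exp 1 * φ₀₀ * t₀₀ * (1 / Bf) ≤ 1 / 4 := by
    rw [mul_one_div, div_le_iff₀ hBf0]
    have h0 : 0 ≤ exp 1 * φ₀₀ * t₀₀ * sC₀ := by positivity
    calc exp 1 * φ₀₀ * t₀₀ = (4 * exp 1 * φ₀₀ * t₀₀ * (1 + sC₀) - 4 * (exp 1 * φ₀₀ * t₀₀ * sC₀)) / 4 := by ring
      _ ≤ (Bf - 0) / 4 := by gcongr; linarith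
      _ = 1 / 4 * Bf := by ring
  -- `uf₀` below each of its members
  have huf1 : uf₀ ≤ 1 := by rw [huf₀]; exact min_le_left _ _
  have huf2 : uf₀ ≤ 1 / (8 * s₀₀ * QH₀ + 1) := by rw [huf₀]; exact (min_le_right _ _).trans (min_le_left _ _)
  have huf3 : uf₀ ≤ 1 / (2 * exp 1 * t₀₀ * QH₀ + 1) := by rw [huf₀]; exact (min_le_right _ _).trans ((min_le_right _ _).trans (min_le_left _ _))
  have huf5 : uf₀ ≤ 1 / (4 * Θ₀ + 1) := by rw [huf₀]; exact (min_le_right _ _).trans ((min_le_right _ _).trans (min_le_right _ _))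
  refine ⟨huf₀0, haT₁0, hqT₁0, hCEf₀0, ?_⟩
  -- §1 the binders
  intro β M _ hβ hβM Ab₀ Qb₀ ι₂₀ hAb₀ hQb₀ hι₂₀0 hι₂₀ αb₀ κb₀ crb₀ ccb₀ W₀ Z₀ σ₀ τ₀ ψ₀ Φ₀
    hαb₀ hκb₀ hcrb₀ hccb₀ hW₀ hZ₀ hσ₀ hτ₀ hψ₀ hΦ₀ A'₀ Q'₀ ι₃₀ hA'₀ hQ'₀ hι₃₀
  have hM0 : (0 : ℝ) < M := Nat.cast_pos.2 (Nat.pos_of_ne_zero (NeZero.ne M))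
  have hβ0 : β ≠ 0 := hβ.ne'
  have hMne : (M : ℝ) ≠ 0 := hM0.ne'
  set r : ℝ := β / M with hr
  have hr0 : 0 < r := by positivity
  have hr1 : r ≤ 1 := by rw [hr, div_le_one hM0]; exact hβM
  have hMβ : (M : ℝ) / β = 1 / r := by rw [hr]; field_simp
  have hMβ2 : ((M : ℝ) / β) ^ 2 = 1 / r ^ 2 := by rw [hMβ]; field_simp
  have hitw : imagTimeWeight β M = r / 2 := by rw [imagTimeWeight, hr]; field_simp
  -- §2 the pins in closed form, then eliminate `W₀ Z₀ σ₀ Φ₀ ψ₀ τ₀`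
  have hW' : W₀ = W₀₀ := by rw [hW₀₀]; exact levPinW_W hCJ₀.ne' hβ0 hMne hcrb₀ hccb₀ hW₀
  have hZ' : Z₀ = Z₀₀ := by rw [hZ₀₀]; exact levPinW_Z hβ0 hMne hccb₀ hZ₀
  have hσ' : σ₀ = s₀₀ * r ^ 2 := by rw [hs₀₀, hr]; exact levPinW_σ hCκ₀ hCJ₀.ne' hβ0 hMne hκb₀ hccb₀ hσ₀
  have hτ' : τ₀ = t₀₀ * r ^ 2 := by rw [ht₀₀, hr]; exact levPinW_τ hCκ₀ hCJ₀.ne' hβ0 hMne hκb₀ hccb₀ hτ₀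
  have hψ' : ψ₀ = p₀₀ / r ^ 2 := by rw [levPinW_ψ hCκ₀ hCJ₀.ne' hβ0 hMne hκb₀ hccb₀ hψ₀, hMβ2, hp₀₀]; ring
  have hΦ' : Φ₀ = φ₀₀ / r := by rw [levPinW_Φ hCκ₀ hCJ₀.ne' hβ0 hMne hκb₀ hαb₀ hcrb₀ hccb₀ hΦ₀, hMβ, hφ₀₀]; ring
  clear hW₀ hZ₀ hσ₀ hτ₀ hψ₀ hΦ₀ hαb₀
  subst W₀ Z₀ σ₀ Φ₀ ψ₀ τ₀
  have hΦ0 : 0 ≤ φ₀₀ / r := by positivity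
  have hτ0 : 0 ≤ t₀₀ * r ^ 2 := by positivity
  -- §3 the shaped data
  have hAb₀0 : 0 ≤ Ab₀ := by rw [hAb₀]; positivity
  have hQb2 : Qb₀ = qb₀ / r ^ 2 := by rw [hQb₀, hMβ2]; ring
  have hQb₀0 : 0 ≤ Qb₀ := by rw [hQb2]; positivity
  have hQbhi : Qb₀ ≤ qb₀ / r ^ 2 := le_of_eq hQb2
  have hr2 : 0 < r ^ 2 := by positivity
  have hQ'₁ : QL₀ / r ^ 2 ≤ Q'₀ := by rw [hQ'₀, hQL₀, hQb2]; rw [mul_div_assoc]; linarith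
  have hZQb : 0 ≤ Z₀₀ * Qb₀ := by positivity
  have hQ'1 : 1 ≤ Q'₀ := by rw [hQ'₀]; linarith
  have hQ'₂ : Q'₀ ≤ QH₀ / r ^ 2 := by
    have h1 : (1 : ℝ) ≤ 1 / r ^ 2 := by rw [le_div_iff₀ hr2, one_mul]; exact pow_le_one₀ hr0.le hr1
    rw [hQ'₀, hQH₀, hQb2, add_div, mul_div_assoc]; linarith
  have hQ'0 : 0 < Q'₀ := lt_of_lt_of_le one_pos hQ'1
  have hZQ : Z₀₀ * Qb₀ ≤ Q'₀ := by rw [hQ'₀]; linarith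
  have hZQ3 : Z₀₀ ^ 3 * Qb₀ ^ 3 ≤ Q'₀ ^ 3 := by rw [← mul_pow]; exact pow_le_pow_left₀ hZQb hZQ 3
  have hA'eq : A'₀ = aP₀ * r / Bf ^ 2 := by rw [hA'₀, haP₀, hAb₀]; ring
  have hA'0 : 0 ≤ A'₀ := by rw [hA'eq]; positivity
  have hA'le : A'₀ ≤ aP₀ * r / Bf ^ 2 := le_of_eq hA'eq
  have hA'le' : A'₀ ≤ aP₀ * r := by rw [hA'eq]; exact div_le_self (by positivity) (one_le_pow₀ hBf1)
  have hι₂' : ι₂₀ ≤ i₂₀ / (Bf * r ^ 3) := by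
    have : ((M : ℝ) / β) ^ 3 = 1 / r ^ 3 := by rw [hMβ]; field_simp
    rw [this] at hι₂₀
    refine hι₂₀.trans (le_of_eq ?_)
    field_simp
  have hι₂'' : ι₂₀ ≤ i₂₀ / r ^ 3 := hι₂'.trans (div_le_div_of_nonneg_left hi₂₀ (by positivity) (le_mul_of_one_le_left (by positivity) hBf1))
  have hQr' : Q'₀ * r ^ 2 ≤ QH₀ := (le_div_iff₀ hr2).1 hQ'₂
  have hι₃0 : 0 ≤ ι₃₀ := by rw [hι₃₀]; positivity
  have hι₃' : ι₃₀ ≤ aP₀ * QH₀ ^ 3 / (Bf ^ 2 * r ^ 5) := by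
    rw [hι₃₀, le_div_iff₀ (by positivity)]
    have hQ3 : (Q'₀ * r ^ 2) ^ 3 ≤ QH₀ ^ 3 := pow_le_pow_left₀ (by positivity) hQr' 3
    have hA'r : A'₀ * Bf ^ 2 ≤ aP₀ * r := (le_div_iff₀ (by positivity)).1 hA'le
    refine le_of_mul_le_mul_right ?_ hr0
    calc A'₀ * Q'₀ ^ 3 * (Bf ^ 2 * r ^ 5) * r = A'₀ * Bf ^ 2 * (Q'₀ * r ^ 2) ^ 3 := by ring
      _ ≤ aP₀ * r * QH₀ ^ 3 := mul_le_mul hA'r hQ3 (by positivity) (by positivity)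
      _ = aP₀ * QH₀ ^ 3 * r := by ring
  have hι₃'' : ι₃₀ ≤ aP₀ * QH₀ ^ 3 / r ^ 5 :=
    hι₃'.trans (div_le_div_of_nonneg_left (by positivity) (by positivity) (le_mul_of_one_le_left (by positivity) (one_le_pow₀ hBf1)))
  -- the product bound on the two-leg slot, in the two forms the helpers want
  have hprod_of : ∀ {ι lam : ℝ}, ι * lam ≤ ((M : ℝ) / β) / Bf → ι * lam ≤ 1 / (Bf * r) ∧ ι * lam ≤ (1 / Bf) / r := by
    intro ι lam h
    rw [hMβ] at h
    have e1 : (1 : ℝ) / r / Bf = 1 / (Bf * r) := by rw [div_div, mul_comm]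
    have e2 : (1 : ℝ) / Bf / r = 1 / (Bf * r) := by rw [div_div]
    exact ⟨e1 ▸ h, e2.symm ▸ e1 ▸ h⟩
  refine ⟨⟨hAb₀0, hQb₀0, hA'0, hQ'0, hZQ, hι₃0, hZQ3, hΦ0, hτ0, hW₀₀0, hZ₀₀0⟩, ?_, ?_, ?_, ?_⟩
  -- (i) the five smallness rows
  · intro lam ι₁₀ hlam0 hlamuf hι₁₀0 hprod
    obtain ⟨hprod1, hprod2⟩ := hprod_of hprod
    have hlam1 : lam ≤ 1 := hlamuf.trans huf1
    obtain ⟨_, hx₁⟩ := levNum_x₁_le hr0 hs₀₀0.le rfl hQ'0 hQ'₂ hlam0 (hlamuf.trans huf2)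
    obtain ⟨_, hx₃, hx₂⟩ := levNum_x₃_le hr0 ht₀₀0.le rfl hQ'0 hQ'₂ hlam0 (hlamuf.trans huf3)
    have hS := levNum_S₀_le' hr0 hBf1 hQL₀0 hlam0 hprod1 hι₂₀0 hι₂' hι₃0 hι₃' hA'0 hA'le hQ'₁ hQ'₂
    have hS2 : ι₁₀ * lam + ι₂₀ / (2 * Q'₀) + ι₃₀ / (4 * Q'₀ ^ 2) + A'₀ * Q'₀ / 4 ≤ (0 * lam + (1 + sC₀)) / (Bf * r) := by
      rw [hsC₀]; exact hS.trans (le_of_eq (by ring))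
    have hS0 : 0 ≤ ι₁₀ * lam + ι₂₀ / (2 * Q'₀) + ι₃₀ / (4 * Q'₀ ^ 2) + A'₀ * Q'₀ / 4 := by positivity
    obtain ⟨_, hy⟩ := levNum_y₀_le hr0 ht₀₀0.le hφ₀₀0.le hBf1 rfl rfl hS0 hS2 le_rfl hlam0 (by rw [mul_zero, zero_add, div_one]; exact hlam1) hBfs
    obtain ⟨_, _, hθ⟩ := levNum_θ₀_le' hr0 ht₀₀0.le hφ₀₀0.le rfl rfl hι₁₀0 hprod2 hι₂₀0 hι₂'' hι₃0 hι₃'' hA'0 hA'le' hQ'0 hQ'₂ hlam0 hlam1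
      hx₃ hΘ₀
    exact ⟨by linarith, hx₂, by linarith, by linarith, by linarith [hθ hBfe (hlamuf.trans huf5)]⟩
  -- (ii) the CE row
  · intro lam ι₁₀ hlam0 hlamuf hι₁₀0 hprod Aro Qro Qtot Atot hAro hQro hQtot hAtot
    obtain ⟨hprod1, _⟩ := hprod_of hprod
    have hlam1 : lam ≤ 1 := hlamuf.trans huf1
    obtain ⟨_, hx₁⟩ := levNum_x₁_le hr0 hs₀₀0.le rfl hQ'0 hQ'₂ hlam0 (hlamuf.trans huf2)
    have hS := levNum_S₀_le' hr0 hBf1 hQL₀0 hlam0 hprod1 hι₂₀0 hι₂' hι₃0 hι₃' hA'0 hA'le hQ'₁ hQ'₂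
    have hS2 : ι₁₀ * lam + ι₂₀ / (2 * Q'₀) + ι₃₀ / (4 * Q'₀ ^ 2) + A'₀ * Q'₀ / 4 ≤ (0 * lam + (1 + sC₀)) / (Bf * r) := by
      rw [hsC₀]; exact hS.trans (le_of_eq (by ring))
    have hS0 : 0 ≤ ι₁₀ * lam + ι₂₀ / (2 * Q'₀) + ι₃₀ / (4 * Q'₀ ^ 2) + A'₀ * Q'₀ / 4 := by positivity
    have hS' : ι₁₀ * lam + ι₂₀ / (2 * Q'₀) + ι₃₀ / (4 * Q'₀ ^ 2) + A'₀ * Q'₀ / 4 ≤ (1 + sC₀) / (Bf * r) :=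
      hS2.trans (le_of_eq (by ring))
    obtain ⟨_, hy⟩ := levNum_y₀_le hr0 ht₀₀0.le hφ₀₀0.le hBf1 rfl rfl hS0 hS2 le_rfl hlam0 (by rw [mul_zero, zero_add, div_one]; exact hlam1) hBfs
    have hAt := levNum_Atot₀_le (i₁ := 1) hr0 ht₀₀0 hφ₀₀0.le hBf1 rfl rfl hQL₀0 hQ'₁ hS0 hS' hx₁ hy hA'0 hA'le hAb₀ hCinc₀.le hAro hAtot
    rw [← haT₀] at hAt
    have hAt' : Atot ≤ aT₀ * r := hAt.trans (div_le_self (by positivity) (one_le_pow₀ hBf1))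
    obtain ⟨hQtot0, hQt, -⟩ := levNum_Qtot₀_le hr0 hr1 ht₀₀0.le hp₀₀0.le rfl rfl hQ'0 hQ'₂ hQb₀0 hQbhi hDinc₀ hQro hQtot
    rw [← hqT₀] at hQt
    rw [hitw, hCEf₀]
    exact levNum_CErow_le hr0 hBf1 hQtot0 hQt hAt'
  -- (iii) the domination
  · intro lam ι₁₀ hlam0 hlamuf hι₁₀0 hprod Aro Qro Qtot Atot hAro hQro hQtot hAtot
    obtain ⟨hprod1, _⟩ := hprod_of hprod
    have hlam1 : lam ≤ 1 := hlamuf.trans huf1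
    obtain ⟨_, hx₁⟩ := levNum_x₁_le hr0 hs₀₀0.le rfl hQ'0 hQ'₂ hlam0 (hlamuf.trans huf2)
    have hS := levNum_S₀_le' hr0 hBf1 hQL₀0 hlam0 hprod1 hι₂₀0 hι₂' hι₃0 hι₃' hA'0 hA'le hQ'₁ hQ'₂
    have hS2 : ι₁₀ * lam + ι₂₀ / (2 * Q'₀) + ι₃₀ / (4 * Q'₀ ^ 2) + A'₀ * Q'₀ / 4 ≤ (0 * lam + (1 + sC₀)) / (Bf * r) := by
      rw [hsC₀]; exact hS.trans (le_of_eq (by ring))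
    have hS0 : 0 ≤ ι₁₀ * lam + ι₂₀ / (2 * Q'₀) + ι₃₀ / (4 * Q'₀ ^ 2) + A'₀ * Q'₀ / 4 := by positivity
    have hS' : ι₁₀ * lam + ι₂₀ / (2 * Q'₀) + ι₃₀ / (4 * Q'₀ ^ 2) + A'₀ * Q'₀ / 4 ≤ (1 + sC₀) / (Bf * r) :=
      hS2.trans (le_of_eq (by ring))
    obtain ⟨_, hy⟩ := levNum_y₀_le hr0 ht₀₀0.le hφ₀₀0.le hBf1 rfl rfl hS0 hS2 le_rfl hlam0 (by rw [mul_zero, zero_add, div_one]; exact hlam1) hBfs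
    have hAt := levNum_Atot₀_le (i₁ := 1) hr0 ht₀₀0 hφ₀₀0.le hBf1 rfl rfl hQL₀0 hQ'₁ hS0 hS' hx₁ hy hA'0 hA'le hAb₀ hC₁0.le hAro hAtot
    rw [← haT₁] at hAt
    obtain ⟨-, -, hQt⟩ := levNum_Qtot₀_le hr0 hr1 ht₀₀0.le hp₀₀0.le rfl rfl hQ'0 hQ'₂ hQb₀0 hQbhi hDinc₁ hQro hQtot
    refine ⟨hAt, ?_⟩
    rw [hMβ2, ← hqT₁] at *
    calc Qtot ≤ qT₁ / r ^ 2 := hQt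
      _ = qT₁ * (1 / r ^ 2) := by ring
  -- (iv) the kit guard
  · intro lam ι₁₀ hlam0 hlamuf hι₁₀0 hprod D μ hμ0 hμ1 hμ2 hμ3 hprof
    obtain ⟨_, hprod2⟩ := hprod_of hprod
    have hlam1 : lam ≤ 1 := hlamuf.trans huf1
    obtain ⟨_, hx₃, -⟩ := levNum_x₃_le hr0 ht₀₀0.le rfl hQ'0 hQ'₂ hlam0 (hlamuf.trans huf3)
    obtain ⟨_, _, hθ⟩ := levNum_θ₀_le' hr0 ht₀₀0.le hφ₀₀0.le rfl rfl hι₁₀0 hprod2 hι₂₀0 hι₂'' hι₃0 hι₃'' hA'0 hA'le' hQ'0 hQ'₂ hlam0 hlam1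
      hx₃ hΘ₀
    exact levNum_guard₀_lt hΦ0 hτ0 hlam0 hQ'0.le hA'0 hμ0 hμ1 hμ2 hμ3 hprof (by linarith) (hθ hBfe (hlamuf.trans huf5))

end Summit.HubbardSuperconductivity.HubbardSuperconductivity.Theorems.EngineV8

end
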